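import Summits.QuantumFields.BalabanUV.Beta.CombMixedT2EvenStoreyTwo

/-!
# `BalabanUV.Beta.CombMixedT2EvenStoreyRec` — binder row D1 ∕ (C1), PART 32: **(K2b) IS STOREYWISE AT EVERY DEPTH — THE WARD RECURSION OF THE EVEN COMPOSITE MIXED KERNEL
# ON THE LATTICE**: for an1's (0.4)-SYM bricks at the centred root at all levels, every depth `m`, every level-(m+1) bond `(μ,y)`, finest bonds `f, f′`, gauge function `λ`,
# `Σ'_x Σ_α (λ(x+e_α) − λ x)·½(compMix_{m+1}(μ,y;(α,x),f,f′) + compMix_{m+1}(…,f′,f))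
#   = Σ_{b₁,b₂ ∈ win y} (λ(R_m b₂.2) − λ(R_m b₁.2))·h(μ,y;b₁,b₂)·compLin_m(f;b₁)·compLin_m(f′;b₂) + Σ_{b ∈ win y} ℓ(μ,y;b)·[the same row of the depth-m composite at b]`,
# `R_m v = Lc^m•v + Σ_{k<m} Lc^k•ρ_c` the finest ROOT of the level-`m` block `v` — with the key brick fact **(W-lin)_m**: the `m`-fold composite linear transport is EXACT on pure
# gauges, `Σ'_x Σ_α (λ(x+e_α) − λ x)·compLin_m((α,x);(κ,u)) = λ(R_m(u+e_κ)) − λ(R_m u)` (J-NOTE-13 §3 ∕ J-NOTE-14 §3's induction, now a theorem)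

WHY (J-NOTE-14 §3∕§5 `HOME/b2b-balaban-beta-an2/gen70/J14-K2B-STOREYWISE.md`; Engine C TIER V-A `γ = −1` at depth 2; road FP A-3 → v7 storeywise).  PART 30 proved the depth-2 case
with the depth-1 composites replaced by bricks; v5's boxes are depth `n + 2`, so v7 needs every depth.  `compMixKer_succ`'s five summands at depth `m+1`: S2+S3 die under the even half
by the antisymmetry of the TOP Hessian brick whatever the lower composites are (§2 `even_S23_eq_zero`), S4 dies by the antisymmetry of the LOWER COMPOSITE Hessian `compVHKer ℓ 𝒽 m`
(F6a `compVHKer_swap`; §2 `even_S4_eq_zero`), S1 carries the `m`-fold transports of all three bonds — (W-lin)_m (§1, induction over `compLinKer_succ` with (W-lin)₁ = GAN24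
`tsum_sum_symLinKerAt_mul_grad` at each peel) turns the background transport into the level-`m` pure gauge of `λ ∘ R_m`, and PART 25's site law at level `m` (§2
`sum_offs_grad_mul_symMixKerAt_even`, arbitrary level function) gives the top storey; S5 is the top linear brick times the depth-`m` composite's own row — the recursion (§3).
No closed form is imposed: the road unrolls with PART 14's storeys or uses the recursion as displayed; the torus form at depth 2 is PART 31 (`CombMixedT2EvenStoreyTwoTorusRow`).

WHAT (`d = 3`, centred root `ρ_c = ctr 4 Lc`, bricks `ℓ 𝓋 𝒽 𝓉 = symLinKerAt ∕ symVhKerAt ∕ symHessKerAt ∕ symMixKerAt (ctr 4 Lc) Lc` constant in the level; [folklore] finite re-indexing and one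
induction BY NAME; no `def`, no `def … : Prop`, nothing cited, 0 sorry):
§1 **`tsum_sum_grad_mul_compLinKer`** ((W-lin)_m, every `m`); §2 `sum_offs_grad_mul_symMixKerAt_even`, `even_S23_eq_zero`, `even_S4_eq_zero`, **`compMixKer_succ_even_eq`** (the even half
of `compMixKer (m+1)` is `even(S1) + even(S5)`, pointwise in the background bond); §3 **`tsum_sum_grad_mul_compMixKer_succ_even`** (the display above).
WHAT THIS IS NOT: not the torus periodisation at depth ≥ 3 (PART 31's engine applies storey by storey — next); not an unrolled closed form; not (J-R₂) nor v7's display (the road's);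
nothing of Bałaban's asserted, valued or discharged; 0 estimates; 0∕4 row-D1 binders (hW, hR, D1Tel, D1Rep); ROOT M‴ p325680 ∕ P5c ∕ D6 untouched; NOT (C1), NOT (T-ID), NOT D1,
NEVER «G-an2-4 closed», NOT BetaPertH, NOT continuum, NOT Clay.

HONEST DEPENDENCY (page 1, mandatory): continuum YM on T⁴ ⇐ BetaPertH ∧ nine spine estimates (0/9 proved); BetaPertH ⇐ (D1) ∧ (D4) ∧ CAP+tail;
G-an2-4 gates asym, D1 and NE2/3/4.  HONEST FRAMING (cell contract, verbatim): «discharging `BetaPertH` makes Bałaban's UV stability UNCONDITIONAL —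
a real constructive-QFT result; it is NOT the continuum limit and NOT the Clay problem.»  ABSOLUTE RULE (cell charter, verbatim): «No internally-minted
statement may enter as a cited fact. Every hypothesis is either kernel-proved in this package or a verbatim quotation of a PUBLISHED theorem with page
reference. The manuscript(s) under audit are NOT citable for their own disputed steps — they are the thing under adjudication; programme-internal
(2001/route/tribunal) claims are never citable.»  Row D1 ∕ (C1) OWNER an2 (b2b-balaban-beta-an2) gen 71, 2026-08-28.  §2∕§3 shaped on PART 30a∕30b (same proofs one composite up).
No existing file touched.
-/

noncomputable section

open scoped BigOperators

namespace Summit.QuantumFields.BalabanUV.Beta.CombMixedT2EvenStoreyRec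

open Finset
open Literature.MathematicalPhysics.QuantumFieldTheory
open Literature.MathematicalPhysics.QuantumFieldTheory.Balaban1983to89
open Literature.MathematicalPhysics.QuantumFieldTheory.Balaban1983to89.Beta
open AffineAveraging (Site box toSite unitVec dz)
open AveragingContoursRooted (ctr ctrOff ctrOff_mem_box)
open AveragingHessianKernels (Bond Near)
open Summit.QuantumFields.BalabanUV.Beta.AxialDressingRooted (one_le_of_neZero)
open Summit.QuantumFields.BalabanUV.Beta.SymAveragingHessianCounts (symLinKerAt symVhKerAt symHessKerAt symHessKerAt_swap symLinKerAt_eq_zero)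
open Summit.QuantumFields.BalabanUV.Beta.SymAveragingMixedJetTables (symMixKerAt)
open Summit.QuantumFields.BalabanUV.Beta.CompositeVertexKernelRec (offs winF wid compLinKer compVHKer compLinKer_succ compLinKer_zero compLinKer_eq_zero
  near_iff_exists_offs mem_winF_succ_of_offs)
open Summit.QuantumFields.BalabanUV.Beta.CompositeHessianTable (compVHKer_swap)
open Summit.QuantumFields.BalabanUV.Beta.CompositeMixedTable (compMixKer compMixKer_succ compMixKer_eq_zero_bg)
open Summit.QuantumFields.BalabanUV.Beta.CombMixedT2EvenPeriodised (symMixKerAt_eq_zero_of_not_near_bond)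
open Summit.QuantumFields.BalabanUV.Beta.CombMixedT2EvenStoreyTwoLetters (tsum_eq_sum_offs tsum_sum_grad_mul_symMixKerAt_even sum4_swap sum4_eq_zero_of_add4
  sum4_eq_zero_of_add2 sum6_push2)
open Summit.QuantumFields.BalabanUV.Beta.CombMixedT2EvenStoreyTwo (tsum_sum_grad_mul_symLinKerAt)

variable {Lc : ℕ} [NeZero Lc]

/-! ## §1 (W-lin)_m: the `m`-fold composite linear transport maps a finest pure gauge to the level-`m` pure gauge of the ROOT-SAMPLED function -/

/-- [folklore] **(W-lin)_m — THE COMPOSITE LINEAR KERNEL IS EXACT ON PURE GAUGES AT EVERY DEPTH**: for an1's sym linear brick at the centred root `ρ_c`, every depth `m`,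
every level-`m` bond `(κ, u)` and every function `λ` on the finest sites,
`Σ'_x Σ_α (λ(x+e_α) − λ x) · compLinKer ℓ Lc m (α,x) (κ,u) = λ(R_m (u+e_κ)) − λ(R_m u)`, `R_m v := Lc^m•v + Σ_{k<m} Lc^k•ρ_c` (the finest ROOT SITE of the level-`m` block `v`:
`R_0 = id`, `R_{m+1} v = R_m (Lc•v + ρ_c)`) — induction over the top peel `compLinKer_succ`, (W-lin)₁ (GAN24 `tsum_sum_symLinKerAt_mul_grad`) at each step. -/
theorem tsum_sum_grad_mul_compLinKer (lam : Site (3 + 1) → ℝ) : ∀ (m : ℕ) (κ : Fin (3 + 1)) (u : Site (3 + 1)),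
    ∑' x : Site (3 + 1), ∑ α : Fin (3 + 1), (lam (x + unitVec α) - lam x) * compLinKer (fun _ => symLinKerAt (ctr 4 Lc) Lc) Lc m (α, x) (κ, u)
      = lam (((Lc ^ m : ℕ) : ℤ) • (u + unitVec κ) + ∑ k ∈ Finset.range m, ((Lc ^ k : ℕ) : ℤ) • ctr 4 Lc)
        - lam (((Lc ^ m : ℕ) : ℤ) • u + ∑ k ∈ Finset.range m, ((Lc ^ k : ℕ) : ℤ) • ctr 4 Lc)
  | 0, κ, u => by
      simp only [compLinKer_zero, pow_zero, Nat.cast_one, one_smul, Finset.range_zero, Finset.sum_empty, add_zero]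
      rw [tsum_eq_single u]
      · simp only [Prod.mk.injEq, and_true, mul_ite, mul_one, mul_zero, Finset.sum_ite_eq, Finset.mem_univ, if_true]
      · intro x hx
        exact Finset.sum_eq_zero fun α _ => by rw [if_neg (fun h => hx ((Prod.mk.inj h).2).symm), mul_zero]
  | m + 1, κ, u => by
      have hLc : 1 ≤ Lc := one_le_of_neZero Lc
      have IH := tsum_sum_grad_mul_compLinKer lam m
      -- top peel: the window bonds `(κ′, Lc•u + e)` of the level-(m+1) bond `(κ, u)`
      have hpt : ∀ x : Site (3 + 1), (∑ α : Fin (3 + 1), (lam (x + unitVec α) - lam x)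
            * compLinKer (fun _ => symLinKerAt (ctr 4 Lc) Lc) Lc (m + 1) (α, x) (κ, u))
          = ∑ κ' : Fin (3 + 1), ∑ e ∈ offs Lc, symLinKerAt (ctr 4 Lc) Lc κ u (κ', (Lc : ℤ) • u + e)
              * ∑ α : Fin (3 + 1), (lam (x + unitVec α) - lam x) * compLinKer (fun _ => symLinKerAt (ctr 4 Lc) Lc) Lc m (α, x) (κ', (Lc : ℤ) • u + e) := fun x => by
        simp only [compLinKer_succ, Finset.mul_sum]
        exact Finset.sum_comm.trans (Finset.sum_congr rfl fun κ' _ => Finset.sum_comm.trans (Finset.sum_congr rfl fun e _ =>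
          Finset.sum_congr rfl fun α _ => by ring))
      -- finite support in the finest site (window of the level-`m` bond)
      have hs : ∀ (κ' : Fin (3 + 1)) (e : Site (3 + 1)), Summable fun x : Site (3 + 1) => symLinKerAt (ctr 4 Lc) Lc κ u (κ', (Lc : ℤ) • u + e)
            * ∑ α : Fin (3 + 1), (lam (x + unitVec α) - lam x) * compLinKer (fun _ => symLinKerAt (ctr 4 Lc) Lc) Lc m (α, x) (κ', (Lc : ℤ) • u + e) := fun κ' e =>
        summable_of_ne_finset_zero (s := winF (Lc ^ m) (wid Lc m) ((Lc : ℤ) • u + e)) fun x hx => by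
          rw [Finset.sum_eq_zero fun α _ => ?_, mul_zero]
          rw [compLinKer_eq_zero m (f := (α, x)) (g := (κ', (Lc : ℤ) • u + e)) hx, mul_zero]
      rw [tsum_congr hpt, Summable.tsum_finsetSum fun κ' _ => summable_sum fun e _ => hs κ' e]
      simp only [Summable.tsum_finsetSum fun e (_ : e ∈ offs Lc) => hs _ e, tsum_mul_left, IH]
      -- (W-lin)₁ at level `m`: the window sum against the level-`m` pure gauge of `Λ_m := λ ∘ R_m`
      have h1 := tsum_sum_grad_mul_symLinKerAt (Lc := Lc)
        (fun v => lam (((Lc ^ m : ℕ) : ℤ) • v + ∑ k ∈ Finset.range m, ((Lc ^ k : ℕ) : ℤ) • ctr 4 Lc)) κ u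
      beta_reduce at h1
      rw [tsum_eq_sum_offs (L := Lc) (y := u)] at h1
      · rw [Finset.sum_comm] at h1
        have e1 : ∀ v : Site (3 + 1), ((Lc ^ m : ℕ) : ℤ) • ((Lc : ℤ) • v + ctr 4 Lc) + ∑ k ∈ Finset.range m, ((Lc ^ k : ℕ) : ℤ) • ctr 4 Lc
            = ((Lc ^ (m + 1) : ℕ) : ℤ) • v + ∑ k ∈ Finset.range (m + 1), ((Lc ^ k : ℕ) : ℤ) • ctr 4 Lc := fun v => by
          rw [Finset.sum_range_succ, smul_add, pow_succ, Nat.cast_mul, mul_smul, ← add_assoc, add_right_comm]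
        rw [← e1, ← e1, ← h1]
        exact Finset.sum_congr rfl fun κ' _ => Finset.sum_congr rfl fun e _ => by ring
      · intro v hv
        refine Finset.sum_eq_zero fun κ' _ => ?_
        rw [show ctr 4 Lc = toSite (ctrOff 4 Lc) from rfl, symLinKerAt_eq_zero (ctrOff_mem_box hLc) (f := (κ', v)) hv, mul_zero]

/-! ## §2 The top brick's site law with an arbitrary level function; the parity kills at every depth -/

/-- [folklore] PART 30a's depth-1 letter AT LEVEL `m`, window form, for an ARBITRARY function `Λ` of the level-`m` sites:
`Σ_κ Σ_{e ∈ offs} (Λ(Lc•y+e+e_κ) − Λ(Lc•y+e))·½(t(μ,y;(κ,Lc•y+e),b₁,b₂) + t(…,b₂,b₁)) = (Λ b₂.2 − Λ b₁.2)·h(μ,y;b₁,b₂)`. -/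
theorem sum_offs_grad_mul_symMixKerAt_even (Lam : Site (3 + 1) → ℝ) (μ : Fin (3 + 1)) (y : Site (3 + 1)) (b₁ b₂ : Bond (3 + 1)) :
    ∑ κ : Fin (3 + 1), ∑ e ∈ offs Lc,
        (Lam ((Lc : ℤ) • y + e + unitVec κ) - Lam ((Lc : ℤ) • y + e))
          * ((1 / 2 : ℝ) * (symMixKerAt (ctr 4 Lc) Lc μ y (κ, (Lc : ℤ) • y + e) b₁ b₂ + symMixKerAt (ctr 4 Lc) Lc μ y (κ, (Lc : ℤ) • y + e) b₂ b₁))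
      = (Lam b₂.2 - Lam b₁.2) * symHessKerAt (ctr 4 Lc) Lc μ y b₁ b₂ := by
  have hLc : 1 ≤ Lc := one_le_of_neZero Lc
  have h := tsum_sum_grad_mul_symMixKerAt_even (Lc := Lc) Lam μ y b₁ b₂
  rw [tsum_eq_sum_offs (L := Lc) (y := y)] at h
  · rw [Finset.sum_comm]
    exact h
  · intro u hu
    refine Finset.sum_eq_zero fun κ _ => ?_
    rw [show ctr 4 Lc = toSite (ctrOff 4 Lc) from rfl, symMixKerAt_eq_zero_of_not_near_bond (ctrOff_mem_box hLc) μ y (g := (κ, u)) hu,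
      symMixKerAt_eq_zero_of_not_near_bond (ctrOff_mem_box hLc) μ y (g := (κ, u)) hu, add_zero, mul_zero, mul_zero]

omit [NeZero Lc] in
/-- [folklore] **PARITY KILL (S2+S3) AT EVERY DEPTH**: the two top-`𝒽`-fed summands of `compMixKer_succ` are each other's negative transpose in the fluctuation pair
(`symHessKerAt_swap` on the TOP brick; the lower composites `compVHKer ℓ 𝓋 m`, `compLinKer ℓ m` are arbitrary). -/
theorem even_S23_eq_zero (m : ℕ) (μ : Fin (3 + 1)) (y : Site (3 + 1)) (g f f' : Bond (3 + 1)) :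
    (∑ κ₁ : Fin (3 + 1), ∑ e₁ ∈ offs Lc, ∑ κ₂ : Fin (3 + 1), ∑ e₂ ∈ offs Lc,
        symHessKerAt (ctr 4 Lc) Lc μ y (κ₁, (Lc : ℤ) • y + e₁) (κ₂, (Lc : ℤ) • y + e₂)
          * compVHKer (fun _ => symLinKerAt (ctr 4 Lc) Lc) (fun _ => symVhKerAt (ctr 4 Lc) Lc) Lc m κ₁ ((Lc : ℤ) • y + e₁) f g
          * compLinKer (fun _ => symLinKerAt (ctr 4 Lc) Lc) Lc m f' (κ₂, (Lc : ℤ) • y + e₂))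
      + (∑ κ₁ : Fin (3 + 1), ∑ e₁ ∈ offs Lc, ∑ κ₂ : Fin (3 + 1), ∑ e₂ ∈ offs Lc,
        symHessKerAt (ctr 4 Lc) Lc μ y (κ₁, (Lc : ℤ) • y + e₁) (κ₂, (Lc : ℤ) • y + e₂)
          * compLinKer (fun _ => symLinKerAt (ctr 4 Lc) Lc) Lc m f (κ₁, (Lc : ℤ) • y + e₁)
          * compVHKer (fun _ => symLinKerAt (ctr 4 Lc) Lc) (fun _ => symVhKerAt (ctr 4 Lc) Lc) Lc m κ₂ ((Lc : ℤ) • y + e₂) f' g)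
      + (∑ κ₁ : Fin (3 + 1), ∑ e₁ ∈ offs Lc, ∑ κ₂ : Fin (3 + 1), ∑ e₂ ∈ offs Lc,
        symHessKerAt (ctr 4 Lc) Lc μ y (κ₁, (Lc : ℤ) • y + e₁) (κ₂, (Lc : ℤ) • y + e₂)
          * compVHKer (fun _ => symLinKerAt (ctr 4 Lc) Lc) (fun _ => symVhKerAt (ctr 4 Lc) Lc) Lc m κ₁ ((Lc : ℤ) • y + e₁) f' g
          * compLinKer (fun _ => symLinKerAt (ctr 4 Lc) Lc) Lc m f (κ₂, (Lc : ℤ) • y + e₂))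
      + (∑ κ₁ : Fin (3 + 1), ∑ e₁ ∈ offs Lc, ∑ κ₂ : Fin (3 + 1), ∑ e₂ ∈ offs Lc,
        symHessKerAt (ctr 4 Lc) Lc μ y (κ₁, (Lc : ℤ) • y + e₁) (κ₂, (Lc : ℤ) • y + e₂)
          * compLinKer (fun _ => symLinKerAt (ctr 4 Lc) Lc) Lc m f' (κ₁, (Lc : ℤ) • y + e₁)
          * compVHKer (fun _ => symLinKerAt (ctr 4 Lc) Lc) (fun _ => symVhKerAt (ctr 4 Lc) Lc) Lc m κ₂ ((Lc : ℤ) • y + e₂) f g) = 0 := by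
  rw [sum4_swap (fun κ₁ e₁ κ₂ e₂ => symHessKerAt (ctr 4 Lc) Lc μ y (κ₁, (Lc : ℤ) • y + e₁) (κ₂, (Lc : ℤ) • y + e₂)
          * compLinKer (fun _ => symLinKerAt (ctr 4 Lc) Lc) Lc m f (κ₁, (Lc : ℤ) • y + e₁)
          * compVHKer (fun _ => symLinKerAt (ctr 4 Lc) Lc) (fun _ => symVhKerAt (ctr 4 Lc) Lc) Lc m κ₂ ((Lc : ℤ) • y + e₂) f' g),
    sum4_swap (fun κ₁ e₁ κ₂ e₂ => symHessKerAt (ctr 4 Lc) Lc μ y (κ₁, (Lc : ℤ) • y + e₁) (κ₂, (Lc : ℤ) • y + e₂)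
          * compLinKer (fun _ => symLinKerAt (ctr 4 Lc) Lc) Lc m f' (κ₁, (Lc : ℤ) • y + e₁)
          * compVHKer (fun _ => symLinKerAt (ctr 4 Lc) Lc) (fun _ => symVhKerAt (ctr 4 Lc) Lc) Lc m κ₂ ((Lc : ℤ) • y + e₂) f g)]
  refine sum4_eq_zero_of_add4 _ _ _ _ fun κ₁ e₁ κ₂ e₂ => ?_
  rw [symHessKerAt_swap (ctr 4 Lc) Lc μ y (κ₁, (Lc : ℤ) • y + e₁) (κ₂, (Lc : ℤ) • y + e₂)]
  ring

omit [NeZero Lc] in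
/-- [folklore] **PARITY KILL (S4) AT EVERY DEPTH**: the top-`𝓋`-fed summand carries the LOWER COMPOSITE Hessian `compVHKer ℓ 𝒽 m`, antisymmetric in the fluctuation pair
(F6a `compVHKer_swap` from `symHessKerAt_swap`): `S4(g;f,f′) + S4(g;f′,f) = 0`. -/
theorem even_S4_eq_zero (m : ℕ) (μ : Fin (3 + 1)) (y : Site (3 + 1)) (g f f' : Bond (3 + 1)) :
    (∑ κ₁ : Fin (3 + 1), ∑ e₁ ∈ offs Lc, ∑ κ : Fin (3 + 1), ∑ e ∈ offs Lc,
        symVhKerAt (ctr 4 Lc) Lc μ y (κ₁, (Lc : ℤ) • y + e₁) (κ, (Lc : ℤ) • y + e)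
          * compVHKer (fun _ => symLinKerAt (ctr 4 Lc) Lc) (fun _ => symHessKerAt (ctr 4 Lc) Lc) Lc m κ₁ ((Lc : ℤ) • y + e₁) f f'
          * compLinKer (fun _ => symLinKerAt (ctr 4 Lc) Lc) Lc m g (κ, (Lc : ℤ) • y + e))
      + (∑ κ₁ : Fin (3 + 1), ∑ e₁ ∈ offs Lc, ∑ κ : Fin (3 + 1), ∑ e ∈ offs Lc,
        symVhKerAt (ctr 4 Lc) Lc μ y (κ₁, (Lc : ℤ) • y + e₁) (κ, (Lc : ℤ) • y + e)
          * compVHKer (fun _ => symLinKerAt (ctr 4 Lc) Lc) (fun _ => symHessKerAt (ctr 4 Lc) Lc) Lc m κ₁ ((Lc : ℤ) • y + e₁) f' f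
          * compLinKer (fun _ => symLinKerAt (ctr 4 Lc) Lc) Lc m g (κ, (Lc : ℤ) • y + e)) = 0 := by
  refine sum4_eq_zero_of_add2 _ _ fun κ₁ e₁ κ e => ?_
  rw [compVHKer_swap (ℓ := fun _ => symLinKerAt (ctr 4 Lc) Lc) (𝒽 := fun _ => symHessKerAt (ctr 4 Lc) Lc) (L := Lc)
    (fun _ μ y f f' => symHessKerAt_swap (ctr 4 Lc) Lc μ y f f') m κ₁ ((Lc : ℤ) • y + e₁) f f']
  ring

omit [NeZero Lc] in
/-- [folklore] **THE EVEN HALF OF THE DEPTH-(m+1) COMPOSITE MIXED KERNEL IS `even(S1) + even(S5)`** (pointwise in the background bond `g`; `compMixKer_succ` + the two parity kills). -/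
theorem compMixKer_succ_even_eq (m : ℕ) (μ : Fin (3 + 1)) (y : Site (3 + 1)) (g f f' : Bond (3 + 1)) :
    compMixKer (fun _ => symLinKerAt (ctr 4 Lc) Lc) (fun _ => symVhKerAt (ctr 4 Lc) Lc) (fun _ => symHessKerAt (ctr 4 Lc) Lc) (fun _ => symMixKerAt (ctr 4 Lc) Lc)
        Lc (m + 1) μ y g f f'
      + compMixKer (fun _ => symLinKerAt (ctr 4 Lc) Lc) (fun _ => symVhKerAt (ctr 4 Lc) Lc) (fun _ => symHessKerAt (ctr 4 Lc) Lc) (fun _ => symMixKerAt (ctr 4 Lc) Lc)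
        Lc (m + 1) μ y g f' f
      = (∑ κ : Fin (3 + 1), ∑ e ∈ offs Lc, ∑ κ₁ : Fin (3 + 1), ∑ e₁ ∈ offs Lc, ∑ κ₂ : Fin (3 + 1), ∑ e₂ ∈ offs Lc,
          (symMixKerAt (ctr 4 Lc) Lc μ y (κ, (Lc : ℤ) • y + e) (κ₁, (Lc : ℤ) • y + e₁) (κ₂, (Lc : ℤ) • y + e₂)
            + symMixKerAt (ctr 4 Lc) Lc μ y (κ, (Lc : ℤ) • y + e) (κ₂, (Lc : ℤ) • y + e₂) (κ₁, (Lc : ℤ) • y + e₁))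
            * compLinKer (fun _ => symLinKerAt (ctr 4 Lc) Lc) Lc m g (κ, (Lc : ℤ) • y + e)
            * compLinKer (fun _ => symLinKerAt (ctr 4 Lc) Lc) Lc m f (κ₁, (Lc : ℤ) • y + e₁)
            * compLinKer (fun _ => symLinKerAt (ctr 4 Lc) Lc) Lc m f' (κ₂, (Lc : ℤ) • y + e₂))
        + ∑ κ : Fin (3 + 1), ∑ e ∈ offs Lc, symLinKerAt (ctr 4 Lc) Lc μ y (κ, (Lc : ℤ) • y + e)
            * (compMixKer (fun _ => symLinKerAt (ctr 4 Lc) Lc) (fun _ => symVhKerAt (ctr 4 Lc) Lc) (fun _ => symHessKerAt (ctr 4 Lc) Lc) (fun _ => symMixKerAt (ctr 4 Lc) Lc)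
                  Lc m κ ((Lc : ℤ) • y + e) g f f'
              + compMixKer (fun _ => symLinKerAt (ctr 4 Lc) Lc) (fun _ => symVhKerAt (ctr 4 Lc) Lc) (fun _ => symHessKerAt (ctr 4 Lc) Lc) (fun _ => symMixKerAt (ctr 4 Lc) Lc)
                  Lc m κ ((Lc : ℤ) • y + e) g f' f) := by
  have h23 := even_S23_eq_zero (Lc := Lc) m μ y g f f'
  have h4 := even_S4_eq_zero (Lc := Lc) m μ y g f f'
  have swap6 : (∑ κ : Fin (3 + 1), ∑ e ∈ offs Lc, ∑ κ₁ : Fin (3 + 1), ∑ e₁ ∈ offs Lc, ∑ κ₂ : Fin (3 + 1), ∑ e₂ ∈ offs Lc,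
          symMixKerAt (ctr 4 Lc) Lc μ y (κ, (Lc : ℤ) • y + e) (κ₁, (Lc : ℤ) • y + e₁) (κ₂, (Lc : ℤ) • y + e₂)
            * compLinKer (fun _ => symLinKerAt (ctr 4 Lc) Lc) Lc m g (κ, (Lc : ℤ) • y + e)
            * compLinKer (fun _ => symLinKerAt (ctr 4 Lc) Lc) Lc m f' (κ₁, (Lc : ℤ) • y + e₁)
            * compLinKer (fun _ => symLinKerAt (ctr 4 Lc) Lc) Lc m f (κ₂, (Lc : ℤ) • y + e₂))
      = ∑ κ : Fin (3 + 1), ∑ e ∈ offs Lc, ∑ κ₁ : Fin (3 + 1), ∑ e₁ ∈ offs Lc, ∑ κ₂ : Fin (3 + 1), ∑ e₂ ∈ offs Lc,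
          symMixKerAt (ctr 4 Lc) Lc μ y (κ, (Lc : ℤ) • y + e) (κ₂, (Lc : ℤ) • y + e₂) (κ₁, (Lc : ℤ) • y + e₁)
            * compLinKer (fun _ => symLinKerAt (ctr 4 Lc) Lc) Lc m g (κ, (Lc : ℤ) • y + e)
            * compLinKer (fun _ => symLinKerAt (ctr 4 Lc) Lc) Lc m f (κ₁, (Lc : ℤ) • y + e₁)
            * compLinKer (fun _ => symLinKerAt (ctr 4 Lc) Lc) Lc m f' (κ₂, (Lc : ℤ) • y + e₂) := by
    refine Finset.sum_congr rfl fun κ _ => Finset.sum_congr rfl fun e _ => ?_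
    rw [sum4_swap (fun κ₁ e₁ κ₂ e₂ => symMixKerAt (ctr 4 Lc) Lc μ y (κ, (Lc : ℤ) • y + e) (κ₁, (Lc : ℤ) • y + e₁) (κ₂, (Lc : ℤ) • y + e₂)
            * compLinKer (fun _ => symLinKerAt (ctr 4 Lc) Lc) Lc m g (κ, (Lc : ℤ) • y + e)
            * compLinKer (fun _ => symLinKerAt (ctr 4 Lc) Lc) Lc m f' (κ₁, (Lc : ℤ) • y + e₁)
            * compLinKer (fun _ => symLinKerAt (ctr 4 Lc) Lc) Lc m f (κ₂, (Lc : ℤ) • y + e₂))]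
    refine Finset.sum_congr rfl fun κ₁ _ => Finset.sum_congr rfl fun e₁ _ => Finset.sum_congr rfl fun κ₂ _ => Finset.sum_congr rfl fun e₂ _ => ?_
    ring
  rw [compMixKer_succ, compMixKer_succ, swap6]
  simp only [add_mul, mul_add, Finset.sum_add_distrib]
  linear_combination h23 + h4

/-! ## §3 (K2b) storeywise at every depth: the recursion -/

/-- [folklore] **`tsum_sum_grad_mul_compMixKer_succ_even` — THE STOREYWISE WARD RECURSION OF THE EVEN COMPOSITE MIXED KERNEL, EVERY DEPTH**: for an1's (0.4)-SYM bricks at the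
centred root at all levels, every depth `m`, every level-(m+1) bond `(μ, y)`, every pair of finest bonds `f, f′` and every gauge function `λ`,
`Σ'_x Σ_α (λ(x+e_α) − λ x)·½(compMix_{m+1}(μ,y;(α,x),f,f′) + compMix_{m+1}(…,f′,f))
 = Σ_{b₁,b₂ ∈ win y} (λ(R_m b₂.2) − λ(R_m b₁.2))·h(μ,y;b₁,b₂)·compLin_m(f;b₁)·compLin_m(f′;b₂) + Σ_{b ∈ win y} ℓ(μ,y;b)·[Σ'_x Σ_α (λ(x+e_α) − λ x)·½(compMix_m(b;(α,x),f,f′) + compMix_m(b;…,f′,f))]`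
(`win y = {(κ, Lc•y+e)}`, `R_m v = Lc^m•v + Σ_{k<m} Lc^k•ρ_c`): the TOP storey's commutator with the gauge function sampled at the level-`m` block ROOTS between the `m`-fold transports,
plus the LOWER composite's own row transported by the top linear brick.  At `m = 1` this is PART 30 (`compMix_1 = 𝓉`, PART 25's site law); v5's box `n` is `m + 1 = n + 2`. -/
theorem tsum_sum_grad_mul_compMixKer_succ_even (lam : Site (3 + 1) → ℝ) (m : ℕ) (μ : Fin (3 + 1)) (y : Site (3 + 1)) (f f' : Bond (3 + 1)) :
    ∑' x : Site (3 + 1), ∑ α : Fin (3 + 1), (lam (x + unitVec α) - lam x)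
        * ((1 / 2 : ℝ) * (compMixKer (fun _ => symLinKerAt (ctr 4 Lc) Lc) (fun _ => symVhKerAt (ctr 4 Lc) Lc) (fun _ => symHessKerAt (ctr 4 Lc) Lc)
              (fun _ => symMixKerAt (ctr 4 Lc) Lc) Lc (m + 1) μ y (α, x) f f'
            + compMixKer (fun _ => symLinKerAt (ctr 4 Lc) Lc) (fun _ => symVhKerAt (ctr 4 Lc) Lc) (fun _ => symHessKerAt (ctr 4 Lc) Lc)
              (fun _ => symMixKerAt (ctr 4 Lc) Lc) Lc (m + 1) μ y (α, x) f' f))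
      = (∑ κ₁ : Fin (3 + 1), ∑ e₁ ∈ offs Lc, ∑ κ₂ : Fin (3 + 1), ∑ e₂ ∈ offs Lc,
          (lam (((Lc ^ m : ℕ) : ℤ) • ((Lc : ℤ) • y + e₂) + ∑ k ∈ Finset.range m, ((Lc ^ k : ℕ) : ℤ) • ctr 4 Lc)
              - lam (((Lc ^ m : ℕ) : ℤ) • ((Lc : ℤ) • y + e₁) + ∑ k ∈ Finset.range m, ((Lc ^ k : ℕ) : ℤ) • ctr 4 Lc))
            * symHessKerAt (ctr 4 Lc) Lc μ y (κ₁, (Lc : ℤ) • y + e₁) (κ₂, (Lc : ℤ) • y + e₂)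
            * compLinKer (fun _ => symLinKerAt (ctr 4 Lc) Lc) Lc m f (κ₁, (Lc : ℤ) • y + e₁)
            * compLinKer (fun _ => symLinKerAt (ctr 4 Lc) Lc) Lc m f' (κ₂, (Lc : ℤ) • y + e₂))
        + ∑ κ : Fin (3 + 1), ∑ e ∈ offs Lc, symLinKerAt (ctr 4 Lc) Lc μ y (κ, (Lc : ℤ) • y + e)
            * ∑' x : Site (3 + 1), ∑ α : Fin (3 + 1), (lam (x + unitVec α) - lam x)
                * ((1 / 2 : ℝ) * (compMixKer (fun _ => symLinKerAt (ctr 4 Lc) Lc) (fun _ => symVhKerAt (ctr 4 Lc) Lc) (fun _ => symHessKerAt (ctr 4 Lc) Lc)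
                      (fun _ => symMixKerAt (ctr 4 Lc) Lc) Lc m κ ((Lc : ℤ) • y + e) (α, x) f f'
                    + compMixKer (fun _ => symLinKerAt (ctr 4 Lc) Lc) (fun _ => symVhKerAt (ctr 4 Lc) Lc) (fun _ => symHessKerAt (ctr 4 Lc) Lc)
                      (fun _ => symMixKerAt (ctr 4 Lc) Lc) Lc m κ ((Lc : ℤ) • y + e) (α, x) f' f)) := by
  -- the top-storey integrand per window bond `b = (κ, Lc•y + e)`
  set C : Fin (3 + 1) → Site (3 + 1) → ℝ := fun κ e => (1 / 2 : ℝ) * ∑ κ₁ : Fin (3 + 1), ∑ e₁ ∈ offs Lc, ∑ κ₂ : Fin (3 + 1), ∑ e₂ ∈ offs Lc,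
      (symMixKerAt (ctr 4 Lc) Lc μ y (κ, (Lc : ℤ) • y + e) (κ₁, (Lc : ℤ) • y + e₁) (κ₂, (Lc : ℤ) • y + e₂)
        + symMixKerAt (ctr 4 Lc) Lc μ y (κ, (Lc : ℤ) • y + e) (κ₂, (Lc : ℤ) • y + e₂) (κ₁, (Lc : ℤ) • y + e₁))
        * compLinKer (fun _ => symLinKerAt (ctr 4 Lc) Lc) Lc m f (κ₁, (Lc : ℤ) • y + e₁)
        * compLinKer (fun _ => symLinKerAt (ctr 4 Lc) Lc) Lc m f' (κ₂, (Lc : ℤ) • y + e₂) with hC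
  -- (pointwise) the even integrand splits into the S1 sector (transport of `g` pulled out) and the S5 sector
  have hsplit : ∀ x : Site (3 + 1), (∑ α : Fin (3 + 1), (lam (x + unitVec α) - lam x)
        * ((1 / 2 : ℝ) * (compMixKer (fun _ => symLinKerAt (ctr 4 Lc) Lc) (fun _ => symVhKerAt (ctr 4 Lc) Lc) (fun _ => symHessKerAt (ctr 4 Lc) Lc)
              (fun _ => symMixKerAt (ctr 4 Lc) Lc) Lc (m + 1) μ y (α, x) f f'
            + compMixKer (fun _ => symLinKerAt (ctr 4 Lc) Lc) (fun _ => symVhKerAt (ctr 4 Lc) Lc) (fun _ => symHessKerAt (ctr 4 Lc) Lc)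
              (fun _ => symMixKerAt (ctr 4 Lc) Lc) Lc (m + 1) μ y (α, x) f' f)))
      = (∑ κ : Fin (3 + 1), ∑ e ∈ offs Lc, (∑ α : Fin (3 + 1), (lam (x + unitVec α) - lam x)
            * compLinKer (fun _ => symLinKerAt (ctr 4 Lc) Lc) Lc m (α, x) (κ, (Lc : ℤ) • y + e)) * C κ e)
        + ∑ κ : Fin (3 + 1), ∑ e ∈ offs Lc, symLinKerAt (ctr 4 Lc) Lc μ y (κ, (Lc : ℤ) • y + e)
            * ∑ α : Fin (3 + 1), (lam (x + unitVec α) - lam x)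
                * ((1 / 2 : ℝ) * (compMixKer (fun _ => symLinKerAt (ctr 4 Lc) Lc) (fun _ => symVhKerAt (ctr 4 Lc) Lc) (fun _ => symHessKerAt (ctr 4 Lc) Lc)
                      (fun _ => symMixKerAt (ctr 4 Lc) Lc) Lc m κ ((Lc : ℤ) • y + e) (α, x) f f'
                    + compMixKer (fun _ => symLinKerAt (ctr 4 Lc) Lc) (fun _ => symVhKerAt (ctr 4 Lc) Lc) (fun _ => symHessKerAt (ctr 4 Lc) Lc)
                      (fun _ => symMixKerAt (ctr 4 Lc) Lc) Lc m κ ((Lc : ℤ) • y + e) (α, x) f' f)) := fun x => by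
    have pull1 : (∑ α : Fin (3 + 1), (lam (x + unitVec α) - lam x)
          * ((1 / 2 : ℝ) * ∑ κ : Fin (3 + 1), ∑ e ∈ offs Lc, ∑ κ₁ : Fin (3 + 1), ∑ e₁ ∈ offs Lc, ∑ κ₂ : Fin (3 + 1), ∑ e₂ ∈ offs Lc,
            (symMixKerAt (ctr 4 Lc) Lc μ y (κ, (Lc : ℤ) • y + e) (κ₁, (Lc : ℤ) • y + e₁) (κ₂, (Lc : ℤ) • y + e₂)
              + symMixKerAt (ctr 4 Lc) Lc μ y (κ, (Lc : ℤ) • y + e) (κ₂, (Lc : ℤ) • y + e₂) (κ₁, (Lc : ℤ) • y + e₁))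
              * compLinKer (fun _ => symLinKerAt (ctr 4 Lc) Lc) Lc m (α, x) (κ, (Lc : ℤ) • y + e)
              * compLinKer (fun _ => symLinKerAt (ctr 4 Lc) Lc) Lc m f (κ₁, (Lc : ℤ) • y + e₁)
              * compLinKer (fun _ => symLinKerAt (ctr 4 Lc) Lc) Lc m f' (κ₂, (Lc : ℤ) • y + e₂)))
        = ∑ κ : Fin (3 + 1), ∑ e ∈ offs Lc, (∑ α : Fin (3 + 1), (lam (x + unitVec α) - lam x)
            * compLinKer (fun _ => symLinKerAt (ctr 4 Lc) Lc) Lc m (α, x) (κ, (Lc : ℤ) • y + e)) * C κ e := by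
      simp only [hC]
      simp only [Finset.sum_mul]
      simp only [Finset.mul_sum]
      refine Finset.sum_comm.trans (Finset.sum_congr rfl fun κ _ => Finset.sum_comm.trans (Finset.sum_congr rfl fun e _ =>
        Finset.sum_congr rfl fun α _ => Finset.sum_congr rfl fun κ₁ _ => Finset.sum_congr rfl fun e₁ _ => Finset.sum_congr rfl fun κ₂ _ =>
        Finset.sum_congr rfl fun e₂ _ => ?_))
      ring
    have pull5 : (∑ α : Fin (3 + 1), (lam (x + unitVec α) - lam x)
          * ((1 / 2 : ℝ) * ∑ κ : Fin (3 + 1), ∑ e ∈ offs Lc, symLinKerAt (ctr 4 Lc) Lc μ y (κ, (Lc : ℤ) • y + e)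
            * (compMixKer (fun _ => symLinKerAt (ctr 4 Lc) Lc) (fun _ => symVhKerAt (ctr 4 Lc) Lc) (fun _ => symHessKerAt (ctr 4 Lc) Lc) (fun _ => symMixKerAt (ctr 4 Lc) Lc)
                  Lc m κ ((Lc : ℤ) • y + e) (α, x) f f'
              + compMixKer (fun _ => symLinKerAt (ctr 4 Lc) Lc) (fun _ => symVhKerAt (ctr 4 Lc) Lc) (fun _ => symHessKerAt (ctr 4 Lc) Lc) (fun _ => symMixKerAt (ctr 4 Lc) Lc)
                  Lc m κ ((Lc : ℤ) • y + e) (α, x) f' f)))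
        = ∑ κ : Fin (3 + 1), ∑ e ∈ offs Lc, symLinKerAt (ctr 4 Lc) Lc μ y (κ, (Lc : ℤ) • y + e)
            * ∑ α : Fin (3 + 1), (lam (x + unitVec α) - lam x)
                * ((1 / 2 : ℝ) * (compMixKer (fun _ => symLinKerAt (ctr 4 Lc) Lc) (fun _ => symVhKerAt (ctr 4 Lc) Lc) (fun _ => symHessKerAt (ctr 4 Lc) Lc)
                      (fun _ => symMixKerAt (ctr 4 Lc) Lc) Lc m κ ((Lc : ℤ) • y + e) (α, x) f f'
                    + compMixKer (fun _ => symLinKerAt (ctr 4 Lc) Lc) (fun _ => symVhKerAt (ctr 4 Lc) Lc) (fun _ => symHessKerAt (ctr 4 Lc) Lc)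
                      (fun _ => symMixKerAt (ctr 4 Lc) Lc) Lc m κ ((Lc : ℤ) • y + e) (α, x) f' f)) := by
      simp only [Finset.mul_sum]
      refine Finset.sum_comm.trans (Finset.sum_congr rfl fun κ _ => Finset.sum_comm.trans (Finset.sum_congr rfl fun e _ =>
        Finset.sum_congr rfl fun α _ => ?_))
      ring
    rw [← pull1, ← pull5, ← Finset.sum_add_distrib]
    refine Finset.sum_congr rfl fun α _ => ?_
    rw [compMixKer_succ_even_eq]
    ring
  -- summability of the two pieces (finite support in the finest site `x`)
  have hs1 : ∀ (κ : Fin (3 + 1)) (e : Site (3 + 1)), Summable fun x : Site (3 + 1) =>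
      (∑ α : Fin (3 + 1), (lam (x + unitVec α) - lam x) * compLinKer (fun _ => symLinKerAt (ctr 4 Lc) Lc) Lc m (α, x) (κ, (Lc : ℤ) • y + e)) * C κ e := fun κ e =>
    summable_of_ne_finset_zero (s := winF (Lc ^ m) (wid Lc m) ((Lc : ℤ) • y + e)) fun x hx => by
      rw [Finset.sum_eq_zero fun α _ => ?_, zero_mul]
      rw [compLinKer_eq_zero m (f := (α, x)) (g := (κ, (Lc : ℤ) • y + e)) hx, mul_zero]
  have hs5 : ∀ (κ : Fin (3 + 1)) (e : Site (3 + 1)), Summable fun x : Site (3 + 1) =>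
      symLinKerAt (ctr 4 Lc) Lc μ y (κ, (Lc : ℤ) • y + e)
        * ∑ α : Fin (3 + 1), (lam (x + unitVec α) - lam x)
            * ((1 / 2 : ℝ) * (compMixKer (fun _ => symLinKerAt (ctr 4 Lc) Lc) (fun _ => symVhKerAt (ctr 4 Lc) Lc) (fun _ => symHessKerAt (ctr 4 Lc) Lc)
                  (fun _ => symMixKerAt (ctr 4 Lc) Lc) Lc m κ ((Lc : ℤ) • y + e) (α, x) f f'
                + compMixKer (fun _ => symLinKerAt (ctr 4 Lc) Lc) (fun _ => symVhKerAt (ctr 4 Lc) Lc) (fun _ => symHessKerAt (ctr 4 Lc) Lc)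
                  (fun _ => symMixKerAt (ctr 4 Lc) Lc) Lc m κ ((Lc : ℤ) • y + e) (α, x) f' f)) := fun κ e =>
    summable_of_ne_finset_zero (s := winF (Lc ^ m) (wid Lc m) ((Lc : ℤ) • y + e)) fun x hx => by
      rw [Finset.sum_eq_zero fun α _ => ?_, mul_zero]
      rw [compMixKer_eq_zero_bg m (g := (α, x)) f f' hx, compMixKer_eq_zero_bg m (g := (α, x)) f' f hx, add_zero, mul_zero, mul_zero]
  rw [tsum_congr hsplit, Summable.tsum_add (summable_sum fun κ _ => summable_sum fun e he => hs1 κ e) (summable_sum fun κ _ => summable_sum fun e he => hs5 κ e),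
    Summable.tsum_finsetSum (fun κ _ => summable_sum fun e he => hs1 κ e), Summable.tsum_finsetSum (fun κ _ => summable_sum fun e he => hs5 κ e)]
  simp only [Summable.tsum_finsetSum (fun e (_ : e ∈ offs Lc) => hs1 _ e), Summable.tsum_finsetSum (fun e (_ : e ∈ offs Lc) => hs5 _ e), tsum_mul_right, tsum_mul_left]
  -- (W-lin)_m on the S1 legs
  simp only [tsum_sum_grad_mul_compLinKer]
  congr 1
  -- top storey: expand `C`, move the transporting bond innermost, apply the site law AT LEVEL `m` with `Λ_m := λ ∘ R_m`
  simp only [hC, Finset.mul_sum]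
  rw [sum6_push2]
  refine Finset.sum_congr rfl fun κ₁ _ => Finset.sum_congr rfl fun e₁ _ => Finset.sum_congr rfl fun κ₂ _ => Finset.sum_congr rfl fun e₂ _ => ?_
  have hA2 := sum_offs_grad_mul_symMixKerAt_even (Lc := Lc)
    (fun v => lam (((Lc ^ m : ℕ) : ℤ) • v + ∑ k ∈ Finset.range m, ((Lc ^ k : ℕ) : ℤ) • ctr 4 Lc)) μ y (κ₁, (Lc : ℤ) • y + e₁) (κ₂, (Lc : ℤ) • y + e₂)
  beta_reduce at hA2
  have hpull : (∑ κ : Fin (3 + 1), ∑ e ∈ offs Lc,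
        (lam (((Lc ^ m : ℕ) : ℤ) • ((Lc : ℤ) • y + e + unitVec κ) + ∑ k ∈ Finset.range m, ((Lc ^ k : ℕ) : ℤ) • ctr 4 Lc)
            - lam (((Lc ^ m : ℕ) : ℤ) • ((Lc : ℤ) • y + e) + ∑ k ∈ Finset.range m, ((Lc ^ k : ℕ) : ℤ) • ctr 4 Lc))
          * ((1 / 2 : ℝ) * ((symMixKerAt (ctr 4 Lc) Lc μ y (κ, (Lc : ℤ) • y + e) (κ₁, (Lc : ℤ) • y + e₁) (κ₂, (Lc : ℤ) • y + e₂)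
              + symMixKerAt (ctr 4 Lc) Lc μ y (κ, (Lc : ℤ) • y + e) (κ₂, (Lc : ℤ) • y + e₂) (κ₁, (Lc : ℤ) • y + e₁))
              * compLinKer (fun _ => symLinKerAt (ctr 4 Lc) Lc) Lc m f (κ₁, (Lc : ℤ) • y + e₁)
              * compLinKer (fun _ => symLinKerAt (ctr 4 Lc) Lc) Lc m f' (κ₂, (Lc : ℤ) • y + e₂))))
      = (∑ κ : Fin (3 + 1), ∑ e ∈ offs Lc,
          (lam (((Lc ^ m : ℕ) : ℤ) • ((Lc : ℤ) • y + e + unitVec κ) + ∑ k ∈ Finset.range m, ((Lc ^ k : ℕ) : ℤ) • ctr 4 Lc)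
              - lam (((Lc ^ m : ℕ) : ℤ) • ((Lc : ℤ) • y + e) + ∑ k ∈ Finset.range m, ((Lc ^ k : ℕ) : ℤ) • ctr 4 Lc))
            * ((1 / 2 : ℝ) * (symMixKerAt (ctr 4 Lc) Lc μ y (κ, (Lc : ℤ) • y + e) (κ₁, (Lc : ℤ) • y + e₁) (κ₂, (Lc : ℤ) • y + e₂)
              + symMixKerAt (ctr 4 Lc) Lc μ y (κ, (Lc : ℤ) • y + e) (κ₂, (Lc : ℤ) • y + e₂) (κ₁, (Lc : ℤ) • y + e₁))))
          * (compLinKer (fun _ => symLinKerAt (ctr 4 Lc) Lc) Lc m f (κ₁, (Lc : ℤ) • y + e₁)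
              * compLinKer (fun _ => symLinKerAt (ctr 4 Lc) Lc) Lc m f' (κ₂, (Lc : ℤ) • y + e₂)) := by
    rw [Finset.sum_mul]
    refine Finset.sum_congr rfl fun κ _ => ?_
    rw [Finset.sum_mul]
    refine Finset.sum_congr rfl fun e _ => ?_
    ring
  rw [hpull, hA2]
  ring

end Summit.QuantumFields.BalabanUV.Beta.CombMixedT2EvenStoreyRec

end
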